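import Summits.CriticalPhenomena.PercolationContinuityZ3.Theorems.Transplant.SkelPhiFaceRouteHrouteX4
import Summits.CriticalPhenomena.PercolationContinuityZ3.Theorems.Transplant.SkelPhiFaceRouteHrouteY4
import Summits.CriticalPhenomena.PercolationContinuityZ3.Theorems.Transplant.SkelPhiFaceRunNb2
import Summits.CriticalPhenomena.PercolationContinuityZ3.Theorems.Transplant.SkelPhiFaceExitTable
import HarnessLib

/-!
# N1 ({±1} node), (F) column, part F5-5 (hp-8 g33): **THE `hkits` HYPOTHESIS OF `faceOblRM_fineNb2` FROM THE KIT INPUTS AND THE PER-CENTRE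
# NUMBERS** — for every face step of the twin scheme's exploration (`h, e, du, j, o`), every kit level `j'` has its `SHyp` datum with seeds off
# the support and faces well-connected to the target (`hkits_faceStepWNbG`, p299284), the exit pieces being the orientation-aware face table
# `pexFO` (p299393, `hPex_pexFO`), the subbox fact `isSubbox_faceStepWNb`, and the ROUTE at every centre `hroute_of_faceRunNums_x/_y` (R5a) fed by
# the per-centre numbers `numsX/numsY : … → FaceRunNums …` (p300269); the realised radii of `concRadii2N` give `hR/hrim` from `r₀ + 1 ≤ 2L′`.
# What remains after this file: the served inputs (c-uniform, stmt-g14's servers), the integer floors, and the per-centre arithmetic (R5b).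
builds on p205010 (kernel theorem, internal audit signed; external expert review pending) — nothing in this file uses p205010; no claim about the open node.
Lane `prim-bschramm`, seat `prim-hp-8` (gen 33); helper file (`--supports stmt-CriticalPhenomena-4575 --as helper`).
* **`Skelφ.hkits_faceSteps_of_nums5`** (= `hkits_faceSteps_of_nums4` with the per-centre numbers ALSO given the face-centre vertex `yF`,
  `ψ yF = faceCen`, `pc = relφ yF` and `j < K` — what `cell_of_frame_box` needs to read the contact's cell); supersedes `hkits_faceSteps_of_nums4` (conclusion = the `hkits` binder of `faceOblRM_fineNb2`, verbatim; supersedes `hkits_faceSteps_of_nums`: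
  the per-centre numbers target the history-free `targetMM` = `M ∪ RimG`, reachable by far last cores).
[cite: KozmaNitzan2024, §4 Lemma 10 (pp. 17–21), Lemma 12 (pp. 23–25), p. 30 (Step III)] [cite: MartineauTassion2017, §4.3 Lemma 4.2]
-/

noncomputable section

open MeasureTheory ProbabilityTheory
open scoped ENNReal Classical

namespace Summit.CriticalPhenomena.PercolationContinuityZ3.Theorems.Transplant

namespace Skelφ

open Literature.Probability.Percolation Literature.Probability.LatticeModels SimpleGraph GadgetSystem Contour KNCells
open Literature.Probability.Percolation.KozmaNitzan
open Literature.Probability.Percolation.KozmaNitzan.Cells (oth oth_ne sgOf sgOf_sign stepVec_apply_fst eq_oth_of_ne oth_oth)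
open KNLevels ChainPlanar ChainPara
open Literature.Barriers.CriticalPhenomena (graphBall mem_graphBall_self graphBall_mono)
open BoxProdZ2 (ConcRadiiG Erad Frad nQ nS Realised Frad_succ Frad_le_Erad)
open Skel (winGraph routeW excess WinStepData)
open SkelI (tanOff)
open TwoAxis.Para (modulus detD)

variable {V : Type} [DecidableEq V] [Countable V] {G : SimpleGraph V} [G.LocallyFinite] {φ : V → Site 2}

/-- **THE `hkits` HYPOTHESIS OF `faceOblRM_fineNb2` FROM THE KIT INPUTS AND THE PER-CENTRE NUMBERS** (see the module docstring).
[cite: KozmaNitzan2024, §4 Lemma 10 (pp. 17–21), Lemma 12 (pp. 23–25), p. 30 (Step III)] -/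
theorem hkits_faceSteps_of_nums5 {types : Finset V} (hlipφ : Lip G φ) (hstep : Steps G φ) (hfr : Frames G φ types) (hκ : CylConn G φ types)
    {Δg : ℕ} (hΔg : ∀ v, G.degree v ≤ Δg)
    -- the twin scheme over the fine skeleton at `w₀`
    (pr : FinePrm) (w₀ : V) (P : PCells2) (gap gap' : ℕ → ℕ) (E₀ L' : ℕ) (off : Site 2 → ℕ) (b₀ : Fin 2 → ℕ) (q : unitInterval) (δc : ℝ)
    (hb₀ : ∀ i, b₀ i ≤ 3 * P.r i) (hc₀ : 0 < pr.c₀) (hc₁ : 0 < pr.c₁) (hDd : pr.D = detD pr.A pr.n pr.h pr.vα pr.vβ) (hD : 0 < pr.D)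
    (hL0 : pr.c₀ * pr.L 0 + 2 ≤ pr.D) (hL1 : pr.c₁ * pr.L 1 + 2 ≤ pr.D) (hA0 : 0 < pr.A) {nL : ℕ} (hnL : 1 ≤ nL) (hvL : |pr.vα| ≤ nL)
    (hmf : 0 ≤ modulus nL pr.h pr.vα pr.vβ)
    (hgap : ∀ n, 1 ≤ gap n) (hE₀ : 2 ≤ E₀) (hL' : 1 ≤ L') {c : ℕ} {R₁' : ℕ → ℕ} (hgapR : ∀ ρ, c + 2 * L' + R₁' ρ + 2 ≤ gap ρ)
    -- the face-frame data per direction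
    (aw : MDir → ℕ) (Rlev N M : ℕ) {k₀ : ℤ} {kF : Fin 2 → ℤ} (hk₀ : ∀ I, pr.rdN I (pr.bOf I) ≤ pr.rdK I (pr.bOf I) * k₀)
    (hk₀' : ∀ i, 3 * (P.r i : ℤ) + k₀ + 3 ≤ 5 * P.r i)
    (hRlev : ∀ i, Rlev + 4 ≤ 10 * P.s i) (hRlev' : ∀ i, Rlev + 4 ≤ 3 * P.r i)
    (hroomF : ∀ du : MDir,
      pr.Mabs * (aw du + Rlev + 1) + pr.rdN du.1 (pr.bOf du.1) * (Rlev + 2) * pr.D ≤ pr.rdK du.1 (pr.bOf du.1) * kF du.1 * pr.D)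
    (hkF : ∀ I, kF I + 3 ≤ 5 * (P.r (oth I) : ℤ)) {nF : Fin 2 → ℕ} (hnC : ∀ I, (nF I : ℤ) ≤ pr.cOf I * |pr.A| * |pr.lvGen I (pr.bOf I)|)
    (hU3 : ∀ I, pr.D ≤ 3 * (nF I : ℤ)) {E r : ℕ} {δ₂ : ℝ} (hδ₂ : 0 < δ₂)
    -- THE ROUTE BLOCK (c-uniform; all signs)
    (B : ℤ → BridgePrm) (hB : ∀ σ' : ℤ, σ' = 1 ∨ σ' = -1 → BridgeOK (B σ')) {kq : ℕ} (hκL : pr.h.natAbs ≤ kq * nL) (ℓ' R's qB Rl R'₃ qB₃ : ℕ)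
    (hlay : (nL + pr.h.natAbs : ℕ) ≤ (nL : ℤ) * ℓ' + 1)
    (Rlev₁ N₁ j₀₁ j₁₁ Rlev₂ N₂ j₀₂ j₁₂ Rlev₃ N₃' j₀₃ j₁₃ : ℕ) (hRl₁ : ∀ σ' : ℤ, Rlev₁ + 1 ≤ (B σ').R') (hRl₂ : Rlev₂ + 1 ≤ R's) (hRl₃ : Rlev₃ + 1 ≤ R'₃)
    (hj₁ : j₁₁ ≤ Rlev₁) (hj₂ : j₁₂ ≤ Rlev₂) (hj₃ : j₁₃ ≤ Rlev₃)
    (hB0 : ∀ σ' : ℤ, σ' = 1 ∨ σ' = -1 → Finset.Icc (pt nL (σ' * pr.h)) (pt nL (σ' * pr.h + ℓ')) ⊆ Finset.Icc (B σ').B₀lo (B σ').B₀hi) (hRlr : Rl ≤ r)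
    {sα sβ : ℤ} {kA : Fin 2 → ℤ} (hsab : ∀ σ' : ℤ, ∀ x ∈ Finset.Icc (B σ').regionLo (B σ').regionHi, |x 0| ≤ sα ∧ |x 1| ≤ sβ)
    (hsQ : (nL : ℤ) ≤ sα ∧ 3 * (ℓ' : ℤ) + |pr.h| ≤ sβ) {Mz : ℕ} (hMzs : (Mz : ℤ) ≤ sα ∧ (Mz : ℤ) ≤ sβ)
    (hnear₂ : ∀ c w, |φ w 0 - φ c 0| ≤ sα → |φ w 1 - φ c 1| ≤ sβ →
      |fineSkel φ c pr.A nL pr.h pr.vα pr.vβ pr.c₀ pr.c₁ (pr.D / 2) (pr.D / 2) pr.D w 0| ≤ kA 0 ∧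
        |fineSkel φ c pr.A nL pr.h pr.vα pr.vβ pr.c₀ pr.c₁ (pr.D / 2) (pr.D / 2) pr.D w 1| ≤ kA 1)
    {kb : ℕ} (hkbMz : (Mz : ℤ) ≤ kb) (hπ1 : ∀ σ' : ℤ, ((B σ').core1Lo 0).natAbs + ((B σ').core1Lo 1).natAbs ≤ r)
    (hclr₁ : ∀ σ' : ℤ, (kb : ℤ) < (B σ').B₀lo 0 - (B σ').R' - (B σ').pr)
    {Δ' : ℕ} {δ η : ℝ} (hδ : 0 < δ) (hδ1 : δ ≤ 1)
    (hchain : ∀ (c : V) (Nr N₃ : ℕ) (W : Sym2 V → unitInterval) (s : Fin (0 + 1 + Nr + 1 + N₃ + 1) → TStep (winGraph G c r))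
      (T' : Fin (0 + 1 + Nr + 1 + N₃ + 1) → Finset V) (η : ℝ),
      (∀ i, (s i).L.o = (s 0).L.o) →
      (∀ i : Fin (0 + 1 + Nr + 1 + N₃), T' (Fin.castSucc i) ⊆ (s i.succ).L.X 0) →
      (∀ i, T' i ⊆ (s i).T) →
      (∀ i, (s i).KitsAt W q Δ' δ) →
      η ≤ δ / 2 →
      (∀ i, (prodBernoulli W).real (⋃ t ∈ (s i).T \ T' i, openConn (s 0).L.o t) ≤ η) →
      1 - δ < (prodBernoulli W).real (s 0).L.reachB →
        1 - δ₂ ^ 2 < (prodBernoulli W).real (⋃ t ∈ T' (Fin.last (0 + 1 + Nr + 1 + N₃)), openConn (s 0).L.o t))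
    (hcount₁ : 1 / (1 - (q : ℝ)) ^ (Δ' * N₁) ≤ δ * ((Finset.Icc j₀₁ j₁₁).card : ℝ))
    (hcount₂ : 1 / (1 - (q : ℝ)) ^ (Δ' * N₂) ≤ δ * ((Finset.Icc j₀₂ j₁₂).card : ℝ))
    (hcount₃ : 1 / (1 - (q : ℝ)) ^ (Δ' * N₃') ≤ δ * ((Finset.Icc j₀₃ j₁₃).card : ℝ))
    (hη : η ≤ δ / 2)
    (Pb Pr : ApronPrm) {Rs Kmaxb KCmaxb Kmaxr KCmaxr rsb rsr cSb cSr cU r₁ r₂ Rb : ℕ}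
    (hPNb : 1 ≤ Pb.N) (hAb : Pb.A = (Mz : ℤ) + 2)
    (hd1b : Pb.W + Pb.ℓ ≤ Pb.d) (hD1b : Pb.W + Pb.ℓ + Pb.d + 2 ≤ shellD Pb) (hD2b : Pb.ℓ + Rs + Pb.d + 3 ≤ shellD Pb) (hDρb : Rs + 1 ≤ shellD Pb)
    (hℓb : 1 ≤ Pb.ℓ) (hWb : Rs + Pb.ℓ ≤ Pb.W) (hKmaxb : shellD Pb + Pb.W ≤ Kmaxb) (hKCmaxb : shellD Pb + Mz + 1 ≤ KCmaxb)
    (hR'b : cylRadMax G φ types Pb.ℓ (Rs + KCmaxb + (Pb.W + Kmaxb)) ≤ Pb.R')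
    (hwideb : ∀ σ' : ℤ, ∀ j ≤ j₁₁, ∀ i, ((B σ').B₀lo - (j : Site 2)) i + 2 * tanOff Pb.ℓs Pb.M ≤ ((B σ').B₀hi + (j : Site 2)) i)
    (hdwb : ∀ σ' : ℤ, ∀ j ≤ j₁₁, ∀ i, ((B σ').B₀lo - (j : Site 2)) i + (Pb.d + 2 : ℕ) ≤ ((B σ').B₀hi + (j : Site 2)) i)
    (hDwb : ∀ σ' : ℤ, ∀ j ≤ j₁₁, ∀ i, ((B σ').B₀lo - (j : Site 2)) i + ((shellD Pb + 1 + Pb.d + KCmaxb + Rs : ℕ) : ℤ) ≤ ((B σ').B₀hi + (j : Site 2)) i)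
    (hTb : (Pb.W : ℤ) + Kmaxb + Pb.ℓ + 1 ≤ tanOff Pb.ℓs Pb.M) (hT'b : (shellD Pb : ℤ) + KCmaxb + Rs ≤ tanOff Pb.ℓs Pb.M)
    (hr₀b : Pb.N * (tanOff Pb.ℓs Pb.M + 2) + Pb.N * Pb.d + (Pb.W + Kmaxb + Pb.R') + (KCmaxb + Rs) ≤ Pb.r₀) (hRb₀ : Pb.r₀ ≤ r)
    (hrsb : 2 * (1 + Pb.N * (tanOff Pb.ℓs Pb.M + 2) + Pb.N * Pb.d + (Pb.W + Kmaxb + Pb.R') + (KCmaxb + Rs)) ≤ rsb)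
    (hcSb : (Pb.N + 1) * (tanOff Pb.ℓs Pb.M + 1) + (Pb.N + 1) * Pb.d + (2 * Pb.W + 1) * (Kmaxb + 1) * (Δg + 1) ^ Pb.R' ≤ cSb)
    (hEb : ∀ σ' : ℤ, j₁₁ + (Pb.N * (tanOff Pb.ℓs Pb.M + 1) + Pb.N * Pb.d + KCmaxb) ≤ (B σ').R')
    (hreachb : r₁ + (Pb.N * (tanOff Pb.ℓs Pb.M + 1) + Pb.N * Pb.d + KCmaxb) ≤ Pb.r₀) (hr₁ : Rb ≤ r₁) (hr₁R : r₁ ≤ r)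
    (hPNr : kq + 3 ≤ Pr.N) (hAr : Pr.A = (Mz + 1 : ℕ) * (shearUnit nL pr.h : ℤ) + 1)
    (hd1r : Pr.W + Pr.ℓ ≤ Pr.d) (hD1r : Pr.W + Pr.ℓ + Pr.d + 2 ≤ shellD Pr) (hD2r : Pr.ℓ + Rs + Pr.d + 3 ≤ shellD Pr) (hDρr : Rs + 1 ≤ shellD Pr)
    (hℓr : 1 ≤ Pr.ℓ) (hWr : Rs + Pr.ℓ ≤ Pr.W) (hKmaxr : (shellD Pr + Pr.W) * (kq + 1) ≤ Kmaxr) (hKCmaxr : (shellD Pr + Mz + 1) * (kq + 1) ≤ KCmaxr)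
    (hR'r : cylRadMax G φ types Pr.ℓ (Rs + KCmaxr + (Pr.W + Kmaxr)) ≤ Pr.R')
    (hwider : ∀ Nr, ∀ k ≤ Nr, ∀ j ≤ j₁₂, ∀ i, ((xRunSched nL ℓ' pr.h R's qB Nr).lo k - (j : Site 2)) i + 2 * tanOff Pr.ℓs Pr.M ≤
      ((xRunSched nL ℓ' pr.h R's qB Nr).hi k + (j : Site 2)) i)
    (hdwr : ∀ Nr, ∀ k ≤ Nr, ∀ j ≤ j₁₂, ∀ i, ((xRunSched nL ℓ' pr.h R's qB Nr).lo k - (j : Site 2)) i + (Pr.d + 2 : ℕ) ≤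
      ((xRunSched nL ℓ' pr.h R's qB Nr).hi k + (j : Site 2)) i)
    (hDwr : ∀ Nr, ∀ k ≤ Nr, ∀ j ≤ j₁₂, ∀ i, ((xRunSched nL ℓ' pr.h R's qB Nr).lo k - (j : Site 2)) i + ((shellD Pr + 1 + Pr.d + KCmaxr + Rs : ℕ) : ℤ) ≤
      ((xRunSched nL ℓ' pr.h R's qB Nr).hi k + (j : Site 2)) i)
    (hwidey : ∀ N₃, ∀ k ≤ N₃, ∀ j ≤ j₁₃, ∀ i, ((yRunSched hnL hvL hlay R'₃ qB₃ N₃).lo k - (j : Site 2)) i + 2 * tanOff Pr.ℓs Pr.M ≤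
      ((yRunSched hnL hvL hlay R'₃ qB₃ N₃).hi k + (j : Site 2)) i)
    (hdwy : ∀ N₃, ∀ k ≤ N₃, ∀ j ≤ j₁₃, ∀ i, ((yRunSched hnL hvL hlay R'₃ qB₃ N₃).lo k - (j : Site 2)) i + (Pr.d + 2 : ℕ) ≤
      ((yRunSched hnL hvL hlay R'₃ qB₃ N₃).hi k + (j : Site 2)) i)
    (hDwy : ∀ N₃, ∀ k ≤ N₃, ∀ j ≤ j₁₃, ∀ i, ((yRunSched hnL hvL hlay R'₃ qB₃ N₃).lo k - (j : Site 2)) i + ((shellD Pr + 1 + Pr.d + KCmaxr + Rs : ℕ) : ℤ) ≤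
      ((yRunSched hnL hvL hlay R'₃ qB₃ N₃).hi k + (j : Site 2)) i)
    (hwiderY : ∀ Nr, ∀ k ≤ Nr, ∀ j ≤ j₁₂, ∀ i, ((yRunSched hnL hvL hlay R's qB Nr).lo k - (j : Site 2)) i + 2 * tanOff Pr.ℓs Pr.M ≤
      ((yRunSched hnL hvL hlay R's qB Nr).hi k + (j : Site 2)) i)
    (hdwrY : ∀ Nr, ∀ k ≤ Nr, ∀ j ≤ j₁₂, ∀ i, ((yRunSched hnL hvL hlay R's qB Nr).lo k - (j : Site 2)) i + (Pr.d + 2 : ℕ) ≤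
      ((yRunSched hnL hvL hlay R's qB Nr).hi k + (j : Site 2)) i)
    (hDwrY : ∀ Nr, ∀ k ≤ Nr, ∀ j ≤ j₁₂, ∀ i, ((yRunSched hnL hvL hlay R's qB Nr).lo k - (j : Site 2)) i + ((shellD Pr + 1 + Pr.d + KCmaxr + Rs : ℕ) : ℤ) ≤
      ((yRunSched hnL hvL hlay R's qB Nr).hi k + (j : Site 2)) i)
    (hwideyY : ∀ N₃, ∀ k ≤ N₃, ∀ j ≤ j₁₃, ∀ i, ((xRunSched nL ℓ' pr.h R'₃ qB₃ N₃).lo k - (j : Site 2)) i + 2 * tanOff Pr.ℓs Pr.M ≤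
      ((xRunSched nL ℓ' pr.h R'₃ qB₃ N₃).hi k + (j : Site 2)) i)
    (hdwyY : ∀ N₃, ∀ k ≤ N₃, ∀ j ≤ j₁₃, ∀ i, ((xRunSched nL ℓ' pr.h R'₃ qB₃ N₃).lo k - (j : Site 2)) i + (Pr.d + 2 : ℕ) ≤
      ((xRunSched nL ℓ' pr.h R'₃ qB₃ N₃).hi k + (j : Site 2)) i)
    (hDwyY : ∀ N₃, ∀ k ≤ N₃, ∀ j ≤ j₁₃, ∀ i, ((xRunSched nL ℓ' pr.h R'₃ qB₃ N₃).lo k - (j : Site 2)) i + ((shellD Pr + 1 + Pr.d + KCmaxr + Rs : ℕ) : ℤ) ≤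
      ((xRunSched nL ℓ' pr.h R'₃ qB₃ N₃).hi k + (j : Site 2)) i)
    (hTr : (Pr.W : ℤ) + Kmaxr + Pr.ℓ + 1 ≤ tanOff Pr.ℓs Pr.M) (hT'r : (shellD Pr : ℤ) + KCmaxr + Rs ≤ tanOff Pr.ℓs Pr.M)
    (hr₀r : Pr.N * (tanOff Pr.ℓs Pr.M + 2) + Pr.N * Pr.d + (Pr.W + Kmaxr + Pr.R') + (KCmaxr + Rs) ≤ Pr.r₀) (hRr₀ : Pr.r₀ ≤ r)
    (hrsr : 2 * (1 + Pr.N * (tanOff Pr.ℓs Pr.M + 2) + Pr.N * Pr.d + (Pr.W + Kmaxr + Pr.R') + (KCmaxr + Rs)) ≤ rsr)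
    (hcSr : (Pr.N + 1) * (tanOff Pr.ℓs Pr.M + 1) + (Pr.N + 1) * Pr.d + (2 * Pr.W + 1) * (Kmaxr + 1) * (Δg + 1) ^ Pr.R' ≤ cSr)
    (hEr : j₁₂ + (Pr.N * (tanOff Pr.ℓs Pr.M + 1) + Pr.N * Pr.d + KCmaxr) ≤ R's)
    (hEy : j₁₃ + (Pr.N * (tanOff Pr.ℓs Pr.M + 1) + Pr.N * Pr.d + KCmaxr) ≤ R'₃)
    (hreachr : r₂ + (Pr.N * (tanOff Pr.ℓs Pr.M + 1) + Pr.N * Pr.d + KCmaxr) ≤ Pr.r₀) (hr₂ : Rl ≤ r₂) (hr₂R : r₂ ≤ r)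
    (QK : ShortPcO V) (hRgRs : ∀ c', QK.RS c' ≤ Rs) (hRgcard : ∀ c', (RgO G φ QK c').card ≤ cU) (hcU1 : 1 ≤ cU)
    (hnSK : ∀ c', 22 * Mz + 58 ≤ QK.nS c') (hκSK : ∀ c', |QK.hS c'| ≤ 10 * (QK.nS c' : ℤ)) (hℓSK : ∀ c', 24 * Mz + 64 ≤ QK.ℓS c')
    (hκL10 : |pr.h| ≤ 10 * (nL : ℤ))
    (Λc : V → ℕ → Finset V) (kz : ℕ) (hkn : ∀ c', Λc c' kz ⊆ Λc c' Mz) (hΛ : ∀ c', ∀ v ∈ Λc c' Mz, v ∈ RgO G φ QK c' ∧ φ v - φ c' ∈ box 2 Mz)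
    (hZ : ∀ c', (↑(Λc c' Mz) : Set V) ⊆ cyl φ c' Mz) (hMz : Mz < nL) (hclrz : (Mz + 4) * (nL + pr.h.natAbs) ≤ nL * (ℓ' + 1))
    (hcz : ∀ c, c ∈ Λc c kz) (hzconn : ∀ c, ∀ s ∈ Λc c kz, PathIn G (↑(Λc c kz) : Set V) c s) (hRsr : Rs ≤ r)
    (hZU : ∀ c, Λc c kz ⊆ pgramPrismFin G φ c nL pr.h (3 * ℓ') Rl)
    (Qb Fb : ℤ → V → Finset V)
    (hQb : ∀ σ' : ℤ, σ' = 1 ∨ σ' = -1 → ∀ c c', ∀ w ∈ Qb σ' c', w ∈ graphBall G c' Rb ∧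
      rootFrame φ c σ' w ∈ Finset.Icc (rootFrame φ c σ' c' - (((B σ').pr : ℕ) : Site 2)) (rootFrame φ c σ' c' + (((B σ').pr : ℕ) : Site 2)))
    (hFb : ∀ σ' : ℤ, σ' = 1 ∨ σ' = -1 → ∀ c c', ∀ w ∈ Fb σ' c', w ∈ Qb σ' c' ∧
      rootFrame φ c σ' w ∈ Finset.Icc (rootFrame φ c σ' c' + (B σ').dlo) (rootFrame φ c σ' c' + (B σ').dhi))
    (hFZ : ∀ σ' c', Disjoint (Fb σ' c') (Λc c' Mz))
    (kk₁ kk₂ kk₃ : ℕ) (hkN₁ : kk₁ * (Δg + 1) ^ (2 * rsb) ≤ N₁) (hkN₂ : kk₂ * (Δg + 1) ^ (2 * rsr) ≤ N₂) (hkN₃ : kk₃ * (Δg + 1) ^ (2 * rsr) ≤ N₃')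
    (hk₁ : (1 - (q : ℝ) ^ (1 + Δg * cSb + cSb * cU)) ^ kk₁ ≤ δ) (hk₂ : (1 - (q : ℝ) ^ (1 + Δg * cSr + cSr * cU)) ^ kk₂ ≤ δ)
    (hk₃ : (1 - (q : ℝ) ^ (1 + Δg * cSr + cSr * cU)) ^ kk₃ ≤ δ)
    (hzone : ∀ c', 1 - δ ^ 2 < (bondPercolation G q).real (UniqZone.zone G (Λc c') kz Mz))
    (hexitb : ∀ σ' : ℤ, σ' = 1 ∨ σ' = -1 → ∀ c' (i : Fin 2) (σ₀ : ℤˣ), 1 - δ ^ 2 < (bondPercolation G q).real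
      (linkIn (↑(RgO G φ QK c') : Set V) (Λc c' kz) (pexRO G φ QK Mz Pb.A σ' i σ₀ c')))
    (hexitr : ∀ σ' : ℤ, σ' = 1 ∨ σ' = -1 → ∀ c' (i : Fin 2) (σ₀ : ℤˣ), 1 - δ ^ 2 < (bondPercolation G q).real
      (linkIn (↑(RgO G φ QK c') : Set V) (Λc c' kz) (pexXO G φ QK Mz nL pr.h Pr.A σ' i σ₀ c')))
    (hexity : ∀ σT : ℤ, σT = 1 ∨ σT = -1 → ∀ c' (i : Fin 2) (σ₀ : ℤˣ), 1 - δ ^ 2 < (bondPercolation G q).real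
      (linkIn (↑(RgO G φ QK c') : Set V) (Λc c' kz) (pexYO G φ QK Mz nL pr.h Pr.A σT i σ₀ c')))
    (hbridge : ∀ σ' c', 1 - δ ^ 2 < (bondPercolation G q).real (linkIn (↑(Qb σ' c') : Set V) (Λc c' kz) (Fb σ' c')))
    (hlongx : ∀ σ' : ℤ, σ' = 1 ∨ σ' = -1 → ∀ c' (τ : ℤ), τ = 1 ∨ τ = -1 → 1 - δ ^ 2 < (bondPercolation G q).real
      (linkIn (pgramPrism G φ c' nL pr.h (3 * ℓ') Rl) (Λc c' kz) (pgSideHalfW G φ c' nL pr.h ℓ' Rl σ' (σ' * τ))))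
    (hlongy : ∀ σT : ℤ, σT = 1 ∨ σT = -1 → ∀ c' (τ : ℤ), τ = 1 ∨ τ = -1 → 1 - δ ^ 2 < (bondPercolation G q).real
      (linkIn (pgramPrism G φ c' nL pr.h (3 * ℓ') Rl) (Λc c' kz) (pgTopPieceW G φ c' nL pr.h ℓ' Rl σT τ pr.vα)))
    {R₁ : ℕ}
    (hR₁ : ∀ (c' : V) (R' : ℕ), R₁ ≤ R' → ∀ (Rw : ℕ) (D' B' : Finset V), (∀ d ∈ D', d ∈ graphBall G c' Rw) →
      (∀ d ∈ D', ∀ d' ∈ D', φ d - φ d' ∈ box 2 (2 * r)) → B' ⊆ D' → (∀ a ∈ B', a ∈ graphBall G c' Rs) →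
        (bondPercolation G q).real (excess G c' R' D' B') ≤ η)
    (hR₁b : R₁ ≤ r - Pb.r₀) (hR₁r : R₁ ≤ r - Pr.r₀)
    -- the FACE KIT: constants, exit table rooms, reach, inputs at accuracy `δ₂`
    (PA : ApronPrm) {Kmax KCmax rs cS : ℕ} (hPN : 3 ≤ PA.N) (hA : PA.A = (Mz + 1 : ℕ) * pr.D + 1)
    (hd1 : PA.W + PA.ℓ ≤ PA.d) (hD1 : PA.W + PA.ℓ + PA.d + 2 ≤ shellD PA) (hD2 : PA.ℓ + Rs + PA.d + 3 ≤ shellD PA) (hDρ : Rs + 1 ≤ shellD PA)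
    (hℓ : 1 ≤ PA.ℓ) (hW : Rs + PA.ℓ ≤ PA.W) (hKmax : (shellD PA + PA.W) * 3 ≤ Kmax) (hKCmax : (shellD PA + Mz + 1) * 3 ≤ KCmax)
    (hR' : cylRadMax G φ types PA.ℓ (Rs + KCmax + (PA.W + Kmax)) ≤ PA.R')
    (hMtan : tanOff PA.ℓs PA.M ≤ (M : ℤ) + 1) (hMd : PA.d + 2 ≤ 2 * M + 2) (hMD : shellD PA + 1 + PA.d + KCmax + Rs ≤ 2 * M + 2)
    (hT : (PA.W : ℤ) + Kmax + PA.ℓ + 1 ≤ tanOff PA.ℓs PA.M) (hT' : (shellD PA : ℤ) + KCmax + Rs ≤ tanOff PA.ℓs PA.M)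
    (hr₀ : PA.N * (tanOff PA.ℓs PA.M + 2) + PA.N * PA.d + (PA.W + Kmax + PA.R') + (KCmax + Rs) ≤ PA.r₀) (hr₀L : PA.r₀ + 1 ≤ 2 * L')
    (hrs : 2 * (1 + PA.N * (tanOff PA.ℓs PA.M + 2) + PA.N * PA.d + (PA.W + Kmax + PA.R') + (KCmax + Rs)) ≤ rs)
    (hcS : (PA.N + 1) * (tanOff PA.ℓs PA.M + 1) + (PA.N + 1) * PA.d + (2 * PA.W + 1) * (Kmax + 1) * (Δg + 1) ^ PA.R' ≤ cS)
    (hE : Rlev + (PA.N * (tanOff PA.ℓs PA.M + 1) + PA.N * PA.d + KCmax) ≤ E)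
    (hreach : r + (PA.N * (tanOff PA.ℓs PA.M + 1) + PA.N * PA.d + KCmax) ≤ PA.r₀)
    {C MK : ℕ} (hn1 : ∀ c', 1 ≤ QK.nS c') (hEq : ∀ c', ((MK : ℤ) + 1) * (QK.nS c' + |QK.hS c'|) ≤ (QK.nS c' : ℤ) * (QK.ℓS c' + 1))
    (hM4 : 4 * C + 1 ≤ MK) (hn2 : ∀ c', 2 * C ≤ QK.nS c') {kL : Fin 2 → ℤ} (hexitR : PA.A + 2 * pr.D ≤ (C : ℤ) * pr.D)
    (hexitL : ∀ I, PA.A + pr.climC I (pr.bOf I) I + pr.D ≤ kL I * pr.D) (hkC : ∀ I, (kL I + 1) * pr.D ≤ (C : ℤ) * (pr.cOf I * pr.L I))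
    (kk : ℕ) (hN : kk * (Δg + 1) ^ (2 * rs) ≤ N) (hk : (1 - (q : ℝ) ^ (1 + Δg * cS + cS * cU)) ^ kk ≤ δ₂)
    (hzoneK : ∀ c', 1 - δ₂ ^ 2 < (bondPercolation G q).real (UniqZone.zone G (Λc c') kz Mz))
    (hexitK : ∀ (I : Fin 2) c' (i : Fin 2) (σ₀ : ℤˣ), 1 - δ₂ ^ 2 < (bondPercolation G q).real
      (linkIn (↑(RgO G φ QK c') : Set V) (Λc c' kz) (pr.pexFO G φ I (pr.bOf I) QK C i σ₀ c')))
    -- THE PER-CENTRE NUMBERS (x-faces `du.1 = 0`, y′-faces `du.1 = 1`)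
    (numsX : ∀ (a' : ℕ) (x : Site 2) (du : MDir) (j : ℕ) (pc : ℤ) (c' : V), du.1 = 0 → j < P.K → ∀ yF : V,
      pr.ψ φ w₀ yF = P.faceCen x du j → pc = relφ φ w₀ yF (pr.bOf du.1) →
      pr.frame φ w₀ du.1 (pr.bOf du.1) c' ∈ Finset.Icc (loN P x du j pc (aw du) - ((E : ℕ) : Site 2)) (hiN P x du j pc (aw du) + ((E : ℕ) : Site 2)) →
      c' ∈ graphBall G w₀ ((concRadii2N P gap gap' E₀ L' off).rE a' x du - r) →
      FaceRunNums3 G φ (pr.ψ φ w₀) true c' pr.A nL pr.h pr.vα pr.vβ pr.c₀ pr.c₁ pr.D du (sgOf du) (B (sgOf du)) ℓ' R's qB R'₃ qB₃ pr.vα hnL hvL hlay kb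
        (P.farCore x du j k₀) (targetMM G φ pr P w₀ (concRadii2N P gap gap' E₀ L' off) b₀ a' x du L') (Λc c' Mz) r (kA du.1) (kA (oth du.1)))
    (numsY : ∀ (a' : ℕ) (x : Site 2) (du : MDir) (j : ℕ) (pc : ℤ) (c' : V), du.1 = 1 → j < P.K → ∀ yF : V,
      pr.ψ φ w₀ yF = P.faceCen x du j → pc = relφ φ w₀ yF (pr.bOf du.1) →
      pr.frame φ w₀ du.1 (pr.bOf du.1) c' ∈ Finset.Icc (loN P x du j pc (aw du) - ((E : ℕ) : Site 2)) (hiN P x du j pc (aw du) + ((E : ℕ) : Site 2)) →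
      c' ∈ graphBall G w₀ ((concRadii2N P gap gap' E₀ L' off).rE a' x du - r) →
      FaceRunNums3 G φ (pr.ψ φ w₀) false c' pr.A nL pr.h pr.vα pr.vβ pr.c₀ pr.c₁ pr.D du (sgOf du) (B (sgOf du)) ℓ' R's qB R'₃ qB₃ pr.vα hnL hvL hlay kb
        (P.farCore x du j k₀) (targetMM G φ pr P w₀ (concRadii2N P gap gap' E₀ L' off) b₀ a' x du L') (Λc c' Mz) r (kA du.1) (kA (oth du.1))) :
    ∀ (h : ProbeHistory V) (e : Site 2 × MDir),
      let Λ := concRadii2N P gap gap' E₀ L' off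
      let S : KSchA V ℕ := ⟨cellGeomSG₂b G (pr.ψ φ w₀) P w₀ Λ b₀, q, δc⟩
      S.IsRun₂ G h → (S.astOf₂ G h).st.choice = some e → S.Valid₂ G h e →
      ∀ du ∈ S.onward G h (tgt e), ∀ j < P.K, ∀ o : Finset (Sym2 V), ∀ (yF : V) (pc : ℤ),
      pr.ψ φ w₀ yF = P.faceCen (tgt e) du j → pc = relφ φ w₀ yF (pr.bOf du.1) →
      let a := S.aOf₁ G h e
      let a' := S.aOf₂ G h e
      let Q := faceStepWNb G pr φ P w₀ Λ b₀ (pr.bOf du.1) a' (tgt e) du j pc (aw du) Rlev N M L' (S.Sx G h e a a' du)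
      ∀ j' ∈ Finset.Icc Q.j₀ Q.j₁, ∃ (σ : KNLevels.SData V) (Sz : Finset V),
        KNLevels.SHyp (winLData G (pr.frame φ w₀ du.1 (pr.bOf du.1)) Q.root Q.Rπ Q.lo Q.hi Q.root Q.Sfin) j' σ ∧ σ.N ≤ Q.N ∧
        (1 - (S.p : ℝ) ^ σ.sB) ^ σ.k ≤ δ₂ ∧
        Sz ⊆ (winLData G (pr.frame φ w₀ du.1 (pr.bOf du.1)) Q.root Q.Rπ Q.lo Q.hi Q.root Q.Sfin).X j' ∧
        Sz ⊆ stepRg G (pr.frame φ w₀ du.1 (pr.bOf du.1)) Q ∧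
        (∀ x ∈ σ.K, ∀ e' ∈ σ.seed x, e' ∉ wireSet (↑Sz : Set V)) ∧ (∀ x ∈ σ.K, σ.face x ⊆ Sz) ∧
        (∀ x ∈ σ.K, 1 - 3 * δ₂ ≤ (prodBernoulli (S.Wt G h e a a' du j o)).real {ω | ∃ u ∈ σ.face x,
          1 - δ₂ < (prodBernoulli (pinW (S.Wt G h e a a' du j o) (wireSet (↑Sz : Set V)) ω)).real
            (⋃ t ∈ Q.T, openConnIn (↑(stepRg G (pr.frame φ w₀ du.1 (pr.bOf du.1)) Q) : Set V) u t)}) := by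
  intro h e Λ S hrun hch hV du hdu j hj o yF pc hyF hpc a a' Q j' hj'
  -- the two maps and the frame facts
  have hL0' : pr.c₀ * pr.L 0 ≤ pr.D := by omega
  have hL1' : pr.c₁ * pr.L 1 ≤ pr.D := by omega
  have hlipψ : Lip G (pr.ψ φ w₀) := pr.lip_ψ hlipφ w₀ hc₀.le hc₁.le hD hL0' hL1'
  have hws : WeakSteps G (pr.ψ φ w₀) := pr.weakSteps_ψ hstep w₀ hc₀.le hc₁.le hD
  have hψ0 : pr.ψ φ w₀ w₀ = 0 := pr.ψ_base φ w₀ hD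
  have hcI : 0 < pr.cOf du.1 := pr.cOf_pos hc₀ hc₁ du.1
  have hLI : pr.cOf du.1 * pr.L du.1 ≤ pr.D := pr.cOf_mul_L_le hL0' hL1' du.1
  have hnz : pr.lvGen du.1 (pr.bOf du.1) ≠ 0 := pr.lvGen_bOf_ne_zero du.1 (pr.lvGen_ne_zero_of_detD_pos hDd hD du.1)
  have hb : |pr.lvGen du.1 (oth (pr.bOf du.1))| ≤ |pr.lvGen du.1 (pr.bOf du.1)| := pr.abs_lvGen_oth_bOf_le du.1
  have hσ : sgOf du = 1 ∨ sgOf du = -1 := sgOf_sign du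
  have hbpar : (b₀ du.1 : ℤ) + 2 ≤ 5 * P.r du.1 := by
    have h1 : (b₀ du.1 : ℤ) ≤ 3 * P.r du.1 := by exact_mod_cast hb₀ du.1
    have h2 : (1 : ℤ) ≤ P.r du.1 := by exact_mod_cast P.one_le_r du.1
    linarith
  have hbperp : (b₀ (oth du.1) : ℤ) + k₀ + 3 ≤ 5 * P.r (oth du.1) := by
    have h1 : (b₀ (oth du.1) : ℤ) ≤ 3 * P.r (oth du.1) := by exact_mod_cast hb₀ (oth du.1)
    linarith [hk₀' (oth du.1)]
  -- the schedule and the realised radii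
  have hΛW : WFS2 P Λ := concRadii2N_WFS2 P gap gap' E₀ L' off hgap hE₀ hL'
  have hr : Realised (S.aOf₁ G h e) (S.aOf₂ G h e) (tgt e) := realised_of_choice_SG₂b h hch
  have hy : tgt e + stepVec du ≠ 0 := tgt_add_stepVec_ne_zero₂b hψ0 hV hdu
  set g := nQ (S.aOf₁ G h e) (tgt e) with hg
  have hrM : Λ.rM a' (tgt e + stepVec du) = Erad gap gap' E₀ g + gap (Erad gap gap' E₀ g) - L' := by
    change Frad gap gap' E₀ (nQ (S.aOf₂ G h e) (tgt e + stepVec du)) - L' = _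
    rw [hr.nQ_add_stepVec hy, Frad_succ]
  have hrE : Λ.rE a' (tgt e) du = Erad gap gap' E₀ g + gap (Erad gap gap' E₀ g) - 1 := by
    have h1 : nQ (S.aOf₂ G h e) (tgt e + stepVec du) = nS (S.aOf₂ G h e) (tgt e) + 1 := by rw [hr.nQ_add_stepVec hy, hr.nS_eq]
    change (concRadii2N P gap gap' E₀ L' off).rE (S.aOf₂ G h e) (tgt e) du = _
    rw [concRadii2N_rE_eq P gap gap' E₀ L' off h1, hr.nS_eq, Frad_succ]
  have hgapg := hgapR (Erad gap gap' E₀ g)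
  have hR : PA.r₀ ≤ Λ.rE a' (tgt e) du := by rw [hrE]; omega
  have hrim : Λ.rM a' (tgt e + stepVec du) - L' + PA.r₀ ≤ Λ.rE a' (tgt e) du := by rw [hrM, hrE]; omega
  have hrE' : r ≤ Λ.rE a' (tgt e) du := le_trans (by omega) hR
  have hj'M : M + 1 ≤ j' := (Finset.mem_Icc.1 hj').1
  have hj'R : j' ≤ Rlev := (Finset.mem_Icc.1 hj').2
  have hRg : ∀ c', ∀ u ∈ RgO G φ QK c', u ∈ graphBall G c' Rs := fun c' u hu =>
    graphBall_mono G c' (hRgRs c') (RgO_subset_graphBall QK c' u hu)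
  -- the subbox fact, the law off the graph
  have hWD : KNLevels.IsSubbox (winGraph G Q.root Q.Rπ) (S.Wt G h e a a' du j o) S.p (stepRg G (pr.frame φ w₀ du.1 (pr.bOf du.1)) Q) :=
    isSubbox_faceStepWNb hΛW hb₀ hV hdu pc (aw du) Rlev N M L' hlipψ hws
  have hWG : ∀ e', e' ∉ G.edgeSet → S.Wt G h e a a' du j o e' = 0 := fun e' he => KNCells.KSchA.Wt_eq_zero_of_not_mem_edgeSet he
  -- the near reading on the face's axes
  have hI2 : du.1 = 0 ∨ du.1 = 1 := by rcases du with ⟨I, s⟩; fin_cases I <;> simp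
  have hnear₂' : ∀ c' w, |φ w 0 - φ c' 0| ≤ sα → |φ w 1 - φ c' 1| ≤ sβ →
      |fineSkel φ c' pr.A nL pr.h pr.vα pr.vβ pr.c₀ pr.c₁ (pr.D / 2) (pr.D / 2) pr.D w du.1| ≤ kA du.1 ∧
        |fineSkel φ c' pr.A nL pr.h pr.vα pr.vβ pr.c₀ pr.c₁ (pr.D / 2) (pr.D / 2) pr.D w (oth du.1)| ≤ kA (oth du.1) := fun c' w h0 h1 => by
    obtain ⟨k0, k1⟩ := hnear₂ c' w h0 h1
    rcases hI2 with hI | hI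
    · rw [hI]; exact ⟨k0, k1⟩
    · rw [hI]; exact ⟨k1, k0⟩
  -- the exit inequalities of the face table
  have hPex : ∀ (Lo Hi : Site 2) (i : Fin 2) (σ₀ : ℤˣ) (c' : V), ∀ v ∈ pr.pexFO G φ du.1 (pr.bOf du.1) QK C i σ₀ c', v ∈ RgO G φ QK c' ∧
      (pr.sideFormsU_frame φ w₀ du.1 (pr.bOf du.1) (pr.cOf_pos hc₀ hc₁ du.1) hA0.ne' hnz hD Lo Hi i σ₀).lin (φ v) + PA.A +
          pr.climC du.1 (pr.bOf du.1) i ≤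
        (pr.sideFormsU_frame φ w₀ du.1 (pr.bOf du.1) (pr.cOf_pos hc₀ hc₁ du.1) hA0.ne' hnz hD Lo Hi i σ₀).lin (φ c') :=
    fun Lo Hi i σ₀ c' v hv => ⟨pr.pexFO_subset φ du.1 (pr.bOf du.1) QK C i σ₀ c' hv,
      pr.hPex_pexFO φ w₀ du.1 (pr.bOf du.1) hcI hA0.ne' hnz hD hLI hA0 QK hn1 hEq hM4 hn2 hexitR (hexitL du.1) (hkC du.1) Lo Hi i σ₀ c' v hv⟩
  -- THE ROUTE at every centre, by the face's axis
  have hroute : ∀ c', pr.frame φ w₀ du.1 (pr.bOf du.1) c' ∈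
        Finset.Icc (loN P (tgt e) du j pc (aw du) - ((E : ℕ) : Site 2)) (hiN P (tgt e) du j pc (aw du) + ((E : ℕ) : Site 2)) →
      c' ∈ graphBall G w₀ (Λ.rE a' (tgt e) du - r) →
      ∃ Qt Ft : Finset V, Ft ⊆ Q.T ∧ Qt ⊆ stepRg G (pr.frame φ w₀ du.1 (pr.bOf du.1)) Q ∧ Disjoint Ft (Λc c' Mz) ∧
        1 - δ₂ ^ 2 < (prodBernoulli (S.Wt G h e a a' du j o)).real (linkIn (↑Qt : Set V) (Λc c' kz) Ft) := by
    rcases hI2 with hI | hI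
    · exact hroute_of_faceRunNums_x4 hlipφ hstep hfr hκ hΔg pr w₀ du (pr.bOf du.1) hc₀ hc₁ hD hL0' hL1' hA0 hnz hnL hvL hmf P Λ b₀ a'
        (tgt e) j pc (aw du) Rlev N M L' (S.Sx G h e a a' du) (hk₀ du.1) (by omega) hbpar hbperp hrE' hWG hWD hσ (B (sgOf du)) (hB _ hσ) hκL ℓ' R's qB Rl R'₃ qB₃
        hlay Rlev₁ N₁ j₀₁ j₁₁ Rlev₂ N₂ j₀₂ j₁₂ Rlev₃ N₃' j₀₃ j₁₃ (hRl₁ _) hRl₂ hRl₃ hj₁ hj₂ hj₃ (hB0 _ hσ) hRlr (hsab _) hsQ hMzs hnear₂' hkbMz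
        (hπ1 _) (hclr₁ _) hδ hδ1 hchain hcount₁ hcount₂ hcount₃ hη Pb Pr hPNb hAb hd1b hD1b hD2b hDρb hℓb hWb hKmaxb hKCmaxb hR'b (hwideb _)
        (hdwb _) (hDwb _) hTb hT'b hr₀b hRb₀ hrsb hcSb (hEb _) hreachb hr₁ hr₁R hPNr hAr hd1r hD1r hD2r hDρr hℓr hWr hKmaxr hKCmaxr hR'r hwider
        hdwr hDwr hwidey hdwy hDwy hTr hT'r hr₀r hRr₀ hrsr hcSr hEr hEy hreachr hr₂ hr₂R QK hRgRs hRgcard hcU1 hnSK hκSK hℓSK hκL10 Λc kz hkn hΛ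
        hZ hMz hclrz hcz hzconn hRsr hZU (Qb (sgOf du)) (Fb (sgOf du)) (hQb _ hσ) (hFb _ hσ) (hFZ _) kk₁ kk₂ kk₃ hkN₁ hkN₂ hkN₃ hk₁ hk₂ hk₃
        hzone (hexitb _ hσ) (hexitr _ hσ) hexity (hbridge _) (hlongx _ hσ) hlongy hR₁ hR₁b hR₁r
        (fun c' h1 h2 => numsX a' (tgt e) du j pc c' hI hj yF hyF hpc h1 h2)
    · exact hroute_of_faceRunNums_y4 hlipφ hstep hfr hκ hΔg pr w₀ du (pr.bOf du.1) hc₀ hc₁ hD hL0' hL1' hA0 hnz hnL hvL hmf P Λ b₀ a'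
        (tgt e) j pc (aw du) Rlev N M L' (S.Sx G h e a a' du) (hk₀ du.1) (by omega) hbpar hbperp hrE' hWG hWD hσ (B (sgOf du)) (hB _ hσ) hκL ℓ' R's qB Rl R'₃ qB₃
        hlay Rlev₁ N₁ j₀₁ j₁₁ Rlev₂ N₂ j₀₂ j₁₂ Rlev₃ N₃' j₀₃ j₁₃ (hRl₁ _) hRl₂ hRl₃ hj₁ hj₂ hj₃ (hB0 _ hσ) hRlr (hsab _) hsQ hMzs hnear₂' hkbMz
        (hπ1 _) (hclr₁ _) hδ hδ1 hchain hcount₁ hcount₂ hcount₃ hη Pb Pr hPNb hAb hd1b hD1b hD2b hDρb hℓb hWb hKmaxb hKCmaxb hR'b (hwideb _)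
        (hdwb _) (hDwb _) hTb hT'b hr₀b hRb₀ hrsb hcSb (hEb _) hreachb hr₁ hr₁R hPNr hAr hd1r hD1r hD2r hDρr hℓr hWr hKmaxr hKCmaxr hR'r hwiderY
        hdwrY hDwrY hwideyY hdwyY hDwyY hTr hT'r hr₀r hRr₀ hrsr hcSr hEr hEy hreachr hr₂ hr₂R QK hRgRs hRgcard hcU1 hnSK hκSK hℓSK hκL10 Λc kz hkn hΛ
        hZ hMz hclrz hcz hzconn hRsr hZU (Qb (sgOf du)) (Fb (sgOf du)) (hQb _ hσ) (hFb _ hσ) (hFZ _) kk₁ kk₂ kk₃ hkN₁ hkN₂ hkN₃ hk₁ hk₂ hk₃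
        hzone (hexitb _ hσ) hexitr (hexity _ hσ) (hbridge _) hlongx (hlongy _ hσ) hR₁ hR₁b hR₁r
        (fun c' h1 h2 => numsY a' (tgt e) du j pc c' hI hj yF hyF hpc h1 h2)
  -- assemble
  exact hkits_faceStepWNbG hlipφ hstep hfr hκ hΔg hδ₂ pr w₀ du (pr.bOf du.1) hc₀ hc₁ hD hL0' hL1' hA0 hb hnz (hnC du.1) (hU3 du.1) P Λ b₀ a'
    (tgt e) j pc (aw du) Rlev N M L' (S.Sx G h e a a' du) hyF hpc (by omega) (hRlev du.1) (hRlev' (oth du.1)) (hroomF du) (hkF du.1) hj'M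
    hj'R PA hPN hA hd1 hD1 hD2 hDρ hℓ hW hKmax hKCmax hR' hMtan hMd hMD hT hT' hr₀ hR hrs hcS hE hreach hrim (RgO G φ QK) hRg hRgcard hcU1 Λc
    kz hkn hΛ (pr.pexFO G φ du.1 (pr.bOf du.1) QK C) hPex kk hWD hN hk hzoneK (hexitK du.1) hroute

end Skelφ

end Summit.CriticalPhenomena.PercolationContinuityZ3.Theorems.Transplant

end
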